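import Summits.ResolutionOfSingularities.ResolutionOfSingularities.Theorems.FrobeniusClosingPatchingRelPerfectDepthTaylorFlagComap
import HarnessLib

/-!
# Crux `PatchingRelPerfect` (stmt-ResolutionOfSingularities-16161), chain W5.2 — F6 initial state, RING LEVEL:
# pulling chart ideals back along `ψ : A[t] → R` and the first two coefficient ideals of `(p₀ + t p₁, t²)`

[OURS · L1 W5.2 · rung tool] Ring-level lemmas for res-D-pv-055's Taylor initial package (`taylorPackageTwo`, F6 §1
INITIAL, res-L1-w52-plan-1 g7 GO 2026-08-27T08:35:38Z), over res-L1-w52-lead-1's retraction pairs of rings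
(`…DepthTaylorFlagComap` §2: `φk : R → A`, `φr : A → R`, `φk ∘ φr = id`, `ker φk = (t₀)`, `ψ = eval₂RingHom φr t₀ : A[t] → R`):

* `mem_span_X_pow_of_eval₂_mem` — INJECTIVITY MOD `t^ℓ`: if `t₀` is a non-zero-divisor, `ψ h ∈ (t₀^ℓ) ⇒ h ∈ (t^ℓ)`
  (the converse companion of lead-1's truncated identity `exists_eq_eval₂_add_pow_mul`; together:
  `A[t]/(t^ℓ) ≅ R/(t₀^ℓ)`);
* `comap_map_eval₂_eq` — hence `ψ⁻¹(ψ(𝔎)·R) = 𝔎` for every `𝔎 ∋ t^ℓ`, and `comap_eval₂_span_sup_span_pow` — the chart ideal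
  `(ψ q_l)_l + (t₀^ℓ)` pulls back to `(q_l)_l + (t^ℓ)`;
* `coeffIdeal_linear_zero`, `coeffIdeal_linear_one` — for `𝔎 = (p₀ˡ + t·p₁ˡ)_l + (t²)`:
  `coeffIdeal 𝔎 0 = (p₀ˡ)_l` and `coeffIdeal 𝔎 1 = (p₀ˡ)_l + (p₁ˡ)_l` (lead-1's `DepthGraded.Taylor.coeffIdeal`).

At the initial state of a depth-two member these give `coeffFlag 0 = 𝓟(P₀)`, `coeffFlag 1 = 𝓟(P₀, P₁)` chart by chart.
Fact-free. Rung tool of OUR route; nothing here is a statement of the manuscript under review; AI-written, weaker than expert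
review.

## References
* H. Kawanoue, K. Matsuki, *Resolution of singularities of an idealistic filtration in dimension 3 after Benito–Villamayor*,
  Adv. Stud. Pure Math. 70 (2016), §2 (coefficient ideals of the idealistic filtration). [KawanoueMatsuki2016]
* H. Hironaka, *Three key theorems on infinitely near singularities*, Sémin. Congr. 10 (2005), Def. 9.1. [Hironaka2005]
-/

-- `Summit.<Summit>.<Sub>.Theorems` with `Sub = Summit` (single-conjunct summit, D-0017)
set_option linter.dupNamespace false

noncomputable section

open Polynomial

namespace Summit.ResolutionOfSingularities.ResolutionOfSingularities.Theorems

universe u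

namespace DepthGraded.Taylor

/-! ## §1 Injectivity mod `t^ℓ` of `ψ : A[t] → R` and the pull-back of chart ideals -/

section Comap

variable {R A : Type u} [CommRing R] [CommRing A] (φk : R →+* A) (φr : A →+* R) (t₀ : R)
  (hkr : ∀ a, φk (φr a) = a) (hker : RingHom.ker φk = Ideal.span {t₀}) (ht : t₀ ∈ nonZeroDivisors R)

include hkr hker ht in
/-- [OURS · L1 W5.2] **Injectivity mod `t^ℓ`**: for a retraction pair of rings with `ker φk = (t₀)`, `t₀` a
non-zero-divisor, and `ψ = eval₂RingHom φr t₀`: `ψ h ∈ (t₀^ℓ) ⇒ h ∈ (t^ℓ)` (induction on `ℓ`: `coeff₀ h = φk (ψ h) = 0`,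
divide by `t`, cancel `t₀`). [cite: KawanoueMatsuki2016, §2] -/
theorem mem_span_X_pow_of_eval₂_mem :
    ∀ (ℓ : ℕ) (h : A[X]), Polynomial.eval₂RingHom φr t₀ h ∈ Ideal.span {t₀ ^ ℓ} →
      h ∈ Ideal.span {(X : A[X]) ^ ℓ} := by
  have hkt : φk t₀ = 0 := apply_generator_eq_zero φk t₀ hker
  intro ℓ
  induction ℓ with
  | zero => intro h _; simp
  | succ ℓ ih =>
    intro h hh
    -- the constant coefficient vanishes
    have h0 : h.coeff 0 = 0 := by
      rw [← apply_eval₂RingHom_eq_coeff_zero φk φr t₀ hkr hkt h, ← RingHom.mem_ker, hker]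
      exact Ideal.span_singleton_le_span_singleton.mpr (dvd_pow_self t₀ (Nat.succ_ne_zero ℓ)) hh
    obtain ⟨h', rfl⟩ : X ∣ h := Polynomial.X_dvd_iff.mpr h0
    obtain ⟨c, hc⟩ := Ideal.mem_span_singleton'.mp hh
    rw [map_mul, Polynomial.coe_eval₂RingHom, Polynomial.eval₂_X] at hc
    -- cancel `t₀`
    have hc' : t₀ * (Polynomial.eval₂RingHom φr t₀ h' - c * t₀ ^ ℓ) = 0 := by
      rw [mul_sub, Polynomial.coe_eval₂RingHom, ← hc, pow_succ]; ring
    have hmem : Polynomial.eval₂RingHom φr t₀ h' ∈ Ideal.span {t₀ ^ ℓ} := by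
      have h1 : Polynomial.eval₂RingHom φr t₀ h' - c * t₀ ^ ℓ = 0 :=
        (mem_nonZeroDivisors_iff_right.mp ht) _ (by rw [mul_comm]; exact hc')
      rw [sub_eq_zero.mp h1]
      exact Ideal.mul_mem_left _ _ (Ideal.mem_span_singleton_self _)
    rw [pow_succ']
    exact Ideal.mul_mem_mul (Ideal.mem_span_singleton_self X) (ih h' hmem) |>
      (Ideal.span_singleton_mul_span_singleton X ((X : A[X]) ^ ℓ)).le

include hkr hker ht in
/-- [OURS · L1 W5.2] **`ψ⁻¹(ψ(𝔎)R) = 𝔎` for `𝔎 ∋ t^ℓ`**: every element of `ψ(𝔎)R` is `ψ k + t₀^ℓ u` with `k ∈ 𝔎` (truncated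
identity `exists_eq_eval₂_add_pow_mul` on the coefficients), and `ψ(p − k) ∈ (t₀^ℓ)` forces `p − k ∈ (t^ℓ) ⊆ 𝔎`
(`mem_span_X_pow_of_eval₂_mem`). [cite: KawanoueMatsuki2016, §2] -/
theorem comap_map_eval₂_eq {ℓ : ℕ} (𝔎 : Ideal A[X]) (hX : (X : A[X]) ^ ℓ ∈ 𝔎) :
    (𝔎.map (Polynomial.eval₂RingHom φr t₀)).comap (Polynomial.eval₂RingHom φr t₀) = 𝔎 := by
  set ψ := Polynomial.eval₂RingHom φr t₀ with hψ
  refine le_antisymm ?_ Ideal.le_comap_map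
  -- every element of `ψ(𝔎)R` is `ψ k` up to `(t₀^ℓ)`
  have key : ∀ r ∈ 𝔎.map ψ, ∃ k ∈ 𝔎, r - ψ k ∈ Ideal.span {t₀ ^ ℓ} := by
    intro r hr
    refine Submodule.span_induction ?_ ?_ ?_ ?_ hr
    · rintro _ ⟨k, hk, rfl⟩
      exact ⟨k, hk, by rw [sub_self]; exact zero_mem _⟩
    · exact ⟨0, zero_mem _, by rw [map_zero, sub_zero]; exact zero_mem _⟩
    · rintro r r' - - ⟨k, hk, hrk⟩ ⟨k', hk', hrk'⟩
      refine ⟨k + k', add_mem hk hk', ?_⟩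
      have : r + r' - ψ (k + k') = (r - ψ k) + (r' - ψ k') := by rw [map_add]; ring
      rw [this]
      exact add_mem hrk hrk'
    · rintro s r - ⟨k, hk, hrk⟩
      obtain ⟨γ, v, hs⟩ := exists_eq_eval₂_add_pow_mul φk φr t₀ hkr hker ℓ s
      refine ⟨γ * k, 𝔎.mul_mem_left γ hk, ?_⟩
      have : s • r - ψ (γ * k) = ψ γ * (r - ψ k) + r * v * t₀ ^ ℓ := by
        rw [smul_eq_mul, map_mul, hs]; ring
      rw [this]
      exact add_mem (Ideal.mul_mem_left _ _ hrk) (Ideal.mul_mem_left _ _ (Ideal.mem_span_singleton_self _))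
  intro p hp
  obtain ⟨k, hk, hpk⟩ := key (ψ p) (Ideal.mem_comap.mp hp)
  rw [← map_sub] at hpk
  have hmem : p - k ∈ 𝔎 := by
    have h1 := mem_span_X_pow_of_eval₂_mem φk φr t₀ hkr hker ht ℓ (p - k) hpk
    exact (Ideal.span_singleton_le_iff_mem _ |>.mpr hX) h1
  simpa using add_mem hmem hk

include hkr hker ht in
/-- [OURS · L1 W5.2] **Pull-back of a chart ideal**: `ψ⁻¹((ψ q_l)_l + (t₀^ℓ)) = (q_l)_l + (t^ℓ)`.
[cite: KawanoueMatsuki2016, §2] -/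
theorem comap_eval₂_span_sup_span_pow {ι : Type*} (q : ι → A[X]) (ℓ : ℕ) :
    (Ideal.span (Set.range fun l => Polynomial.eval₂RingHom φr t₀ (q l)) ⊔ Ideal.span {t₀ ^ ℓ}).comap
        (Polynomial.eval₂RingHom φr t₀) =
      Ideal.span (Set.range q) ⊔ Ideal.span {(X : A[X]) ^ ℓ} := by
  have hmap : (Ideal.span (Set.range q) ⊔ Ideal.span {(X : A[X]) ^ ℓ}).map (Polynomial.eval₂RingHom φr t₀) =
      Ideal.span (Set.range fun l => Polynomial.eval₂RingHom φr t₀ (q l)) ⊔ Ideal.span {t₀ ^ ℓ} := by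
    rw [Ideal.map_sup, Ideal.map_span, Ideal.map_span, ← Set.range_comp, Set.image_singleton, map_pow,
      Polynomial.coe_eval₂RingHom, Polynomial.eval₂_X]
    rfl
  rw [← hmap]
  exact comap_map_eval₂_eq φk φr t₀ hkr hker ht _ (Ideal.mem_sup_right (Ideal.mem_span_singleton_self _))

end Comap

/-! ## §2 The first two coefficient ideals of `(p₀ˡ + t p₁ˡ)_l + (t²)` -/

section Linear

variable {A : Type u} [CommRing A] {ι : Type*} (p₀ p₁ : ι → A)

/-- Coefficients of order `< 2` of an element of `(p₀ˡ + t p₁ˡ)_l + (t²)`: `coeff₀ ∈ (p₀ˡ)`, `coeff₁ ∈ (p₀ˡ) + (p₁ˡ)`.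
[folklore] -/
theorem coeff_mem_of_mem_linear {p : A[X]}
    (hp : p ∈ Ideal.span (Set.range fun l => C (p₀ l) + X * C (p₁ l)) ⊔ Ideal.span {(X : A[X]) ^ 2}) :
    p.coeff 0 ∈ Ideal.span (Set.range p₀) ∧
      p.coeff 1 ∈ Ideal.span (Set.range p₀) ⊔ Ideal.span (Set.range p₁) := by
  obtain ⟨p', hp', p'', hp'', rfl⟩ := Submodule.mem_sup.mp hp
  -- the `(t²)`-part contributes nothing below order two
  obtain ⟨g, rfl⟩ := Ideal.mem_span_singleton'.mp hp''
  have h2 : ∀ b < 2, (g * X ^ 2 : A[X]).coeff b = 0 := fun b hb => by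
    rw [mul_comm, Polynomial.coeff_X_pow_mul']
    exact if_neg (by omega)
  rw [Polynomial.coeff_add, Polynomial.coeff_add, h2 0 (by norm_num), h2 1 (by norm_num), add_zero, add_zero]
  -- span induction on the linear part
  refine Submodule.span_induction ?_ ?_ ?_ ?_ hp'
  · rintro _ ⟨l, rfl⟩
    constructor
    · have : (C (p₀ l) + X * C (p₁ l)).coeff 0 = p₀ l := by simp
      rw [this]; exact Ideal.subset_span ⟨l, rfl⟩
    · have : (C (p₀ l) + X * C (p₁ l)).coeff 1 = p₁ l := by simp [Polynomial.coeff_C]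
      rw [this]; exact Ideal.mem_sup_right (Ideal.subset_span ⟨l, rfl⟩)
  · simp
  · rintro a b - - ⟨ha0, ha1⟩ ⟨hb0, hb1⟩
    rw [Polynomial.coeff_add, Polynomial.coeff_add]
    exact ⟨add_mem ha0 hb0, add_mem ha1 hb1⟩
  · rintro g a - ⟨ha0, ha1⟩
    rw [smul_eq_mul, Polynomial.coeff_mul, Polynomial.coeff_mul]
    constructor
    · refine Ideal.sum_mem _ fun x hx => ?_
      have hx2 : x.2 = 0 := by
        have := Finset.mem_antidiagonal.mp hx; omega
      rw [hx2]
      exact Ideal.mul_mem_left _ _ ha0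
    · refine Ideal.sum_mem _ fun x hx => ?_
      have hx2 : x.2 = 0 ∨ x.2 = 1 := by
        have := Finset.mem_antidiagonal.mp hx; omega
      rcases hx2 with hx2 | hx2
      · rw [hx2]; exact Ideal.mul_mem_left _ _ (Ideal.mem_sup_left ha0)
      · rw [hx2]; exact Ideal.mul_mem_left _ _ ha1

/-- [OURS · L1 W5.2] **`coeffIdeal ((p₀ˡ + t p₁ˡ)_l + (t²)) 0 = (p₀ˡ)_l`.** [cite: KawanoueMatsuki2016, §2] -/
theorem coeffIdeal_linear_zero :
    coeffIdeal (Ideal.span (Set.range fun l => C (p₀ l) + X * C (p₁ l)) ⊔ Ideal.span {(X : A[X]) ^ 2}) 0 =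
      Ideal.span (Set.range p₀) := by
  apply le_antisymm
  · intro c hc
    obtain ⟨p, hp, rfl⟩ := mem_coeffIdeal_iff.mp hc
    exact (coeff_mem_of_mem_linear p₀ p₁ hp).1
  · refine Ideal.span_le.mpr ?_
    rintro _ ⟨l, rfl⟩
    have h : (C (p₀ l) + X * C (p₁ l)).coeff 0 = p₀ l := by simp
    rw [SetLike.mem_coe, ← h]
    exact coeff_mem_coeffIdeal (Ideal.mem_sup_left (Ideal.subset_span (Set.mem_range_self l))) 0

/-- [OURS · L1 W5.2] **`coeffIdeal ((p₀ˡ + t p₁ˡ)_l + (t²)) 1 = (p₀ˡ)_l + (p₁ˡ)_l`** (`p₁ˡ = coeff₁` of the generator,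
`p₀ˡ = coeff₁` of `t` times it). [cite: KawanoueMatsuki2016, §2] -/
theorem coeffIdeal_linear_one :
    coeffIdeal (Ideal.span (Set.range fun l => C (p₀ l) + X * C (p₁ l)) ⊔ Ideal.span {(X : A[X]) ^ 2}) 1 =
      Ideal.span (Set.range p₀) ⊔ Ideal.span (Set.range p₁) := by
  apply le_antisymm
  · intro c hc
    obtain ⟨p, hp, rfl⟩ := mem_coeffIdeal_iff.mp hc
    exact (coeff_mem_of_mem_linear p₀ p₁ hp).2
  · refine sup_le (Ideal.span_le.mpr ?_) (Ideal.span_le.mpr ?_)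
    · rintro _ ⟨l, rfl⟩
      have h : (X * (C (p₀ l) + X * C (p₁ l))).coeff 1 = p₀ l := by
        rw [Polynomial.coeff_X_mul]; simp
      rw [SetLike.mem_coe, ← h]
      exact coeff_mem_coeffIdeal (Ideal.mul_mem_left _ _ (Ideal.mem_sup_left (Ideal.subset_span (Set.mem_range_self l)))) 1
    · rintro _ ⟨l, rfl⟩
      have h : (C (p₀ l) + X * C (p₁ l)).coeff 1 = p₁ l := by simp [Polynomial.coeff_C]
      rw [SetLike.mem_coe, ← h]
      exact coeff_mem_coeffIdeal (Ideal.mem_sup_left (Ideal.subset_span (Set.mem_range_self l))) 1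

end Linear

end DepthGraded.Taylor

end Summit.ResolutionOfSingularities.ResolutionOfSingularities.Theorems

end
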